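import Summits.RiemannHypothesis.RiemannHypothesis.Theorems.TiltedLandingLaw421R3FlatMenuBBChecker

/-!
# «FlatMenuBBSound» (W-08 C1, rh-idea-5 g42; module 3 of 4 of «FlatMenuBB»)

SOUNDNESS of the checker of module 1 over `ℝ`: monotone factored box bounds for the three reads (`thpF_ge_box`, `asecF_ge_box`,
`ahp_ge_box`; `D0 = 1` makes `ι²` cancel), the two free regions (`asecF_nonneg_of_top'`, `thpF_nonneg_of_bottom'`), one leaf
(`leafOK_sound`), one free box (`inFree_sound`) and the recursion (`bb_sound`: `bb d Q1 Q2 r1 r2 = true` ⇒ the PH reads `PHReads Q r`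
at every real `(Q, r)` of the box that lies in the chart).
Nothing here bears on the truth of RH; RH is not proved (this is a SUPPORT computation for the E5 leaf of the W-08 sink line, not the crux).
-/

namespace RhW08.FlatMenuBB
open RhW08.LimitMenu

/-! ## §3 Monotone factored bounds for the three reads on a clamped box (real side) -/

/-- `0 ≤ ι²E` for `r ≥ 0`. -/
theorem limI_nonneg' (Q r : ℝ) (hr : 0 ≤ r) : 0 ≤ limI Q r := by unfold limI; positivity

/-- the PH A-sector numerator expanded (`D0 = 1`: `asecF = κQW² − 9Q(1−Q)rW − (1−κ)ι²E`). -/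
theorem asecF_PH_eq (Q r : ℝ) :
    asecF (9 / 2) 1 Q r = kap * Q * limW Q r ^ 2 - 9 * (Q * (1 - Q)) * r * limW Q r - (1 - kap) * limI Q r := by
  unfold asecF limN limPhi; ring

/-- the PH half-plane margin factored: `X = Q·W·(W − 9(1−Q)r)`. -/
theorem ahpX_PH_eq (Q r : ℝ) : ahpX (9 / 2) 1 Q r = Q * limW Q r * (limW Q r - 9 * (1 - Q) * r) := by
  unfold ahpX limN limPhi limI; ring

/-- T-read on a box: `thpF (9/25) Q r (μ r) ≥ 64g0(1 − q2) − μh·(q2ρ2 + 1)(q2 + ρ2)`. -/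
theorem thpF_ge_box {Q r q2 ρ2 μh : ℝ} (hQ0 : 0 ≤ Q) (hQq : Q ≤ q2) (hr1 : 1 ≤ r) (hrρ : r ≤ ρ2)
    (hμ : limMu r ≤ μh) :
    64 * (9 / 25) * (1 - q2) - μh * (q2 * ρ2 + 1) * (q2 + ρ2) ≤ thpF (9 / 25) Q r (limMu r) := by
  have hμ0 : 0 ≤ limMu r := by
    unfold limMu; apply le_min
    · apply div_nonneg (by norm_num); linarith
    · norm_num
  have hq2 : 0 ≤ q2 := le_trans hQ0 hQq
  have h1 : (Q * r + 1) * (Q + r) ≤ (q2 * ρ2 + 1) * (q2 + ρ2) := by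
    have : Q * r ≤ q2 * ρ2 := mul_le_mul hQq hrρ (by linarith) hq2
    have h0 : 0 ≤ (Q * r + 1) := by positivity
    nlinarith [mul_le_mul (by linarith : Q * r + 1 ≤ q2 * ρ2 + 1) (by linarith : Q + r ≤ q2 + ρ2) (by linarith) (by linarith)]
  have h2 : limMu r * ((Q * r + 1) * (Q + r)) ≤ μh * ((q2 * ρ2 + 1) * (q2 + ρ2)) :=
    mul_le_mul hμ h1 (by positivity) (le_trans hμ0 hμ)
  unfold thpF
  nlinarith

/-- A-sector read on a box. -/
theorem asecF_ge_box {Q r q1 q2 ρ1 ρ2 qq : ℝ} (hq1 : 0 ≤ q1) (hQq1 : q1 ≤ Q) (hQq2 : Q ≤ q2) (hQ1 : Q ≤ 1)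
    (hρ1 : 0 ≤ ρ1) (hrρ1 : ρ1 ≤ r) (hr1 : 1 ≤ r) (hrρ2 : r ≤ ρ2) (hqq : Q * (1 - Q) ≤ qq) :
    kap * q1 * (ρ1 * ρ1 + 1 + 2 * q1 * ρ1) * (ρ1 * ρ1 + 1 + 2 * q1 * ρ1)
      - 9 * qq * ρ2 * (ρ2 * ρ2 + 1 + 2 * q2 * ρ2) - (1 - kap) * (ρ2 * (ρ2 - 1) * (ρ2 - 1) * (1 - q1) * (1 - q1))
      ≤ asecF (9 / 2) 1 Q r := by
  have hk : (0:ℝ) < kap := by unfold kap; norm_num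
  have hk1 : kap ≤ 1 := by unfold kap; norm_num
  have hQ0 : 0 ≤ Q := le_trans hq1 hQq1
  have hr0 : 0 ≤ r := by linarith
  set W := limW Q r with hW
  set Wlo := ρ1 * ρ1 + 1 + 2 * q1 * ρ1 with hWlo
  set Whi := ρ2 * ρ2 + 1 + 2 * q2 * ρ2 with hWhi
  have hWdef : W = r ^ 2 + 1 + 2 * Q * r := by rw [hW]; unfold limW; ring
  have hWlo0 : 0 ≤ Wlo := by rw [hWlo]; positivity
  have hWloW : Wlo ≤ W := by
    rw [hWdef, hWlo]
    nlinarith [mul_le_mul hQq1 hrρ1 hρ1 hQ0, mul_le_mul hrρ1 hrρ1 hρ1 hr0]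
  have hWWhi : W ≤ Whi := by
    rw [hWdef, hWhi]
    have hq2 : 0 ≤ q2 := le_trans hQ0 hQq2
    nlinarith [mul_le_mul hQq2 hrρ2 hr0 hq2, mul_le_mul hrρ2 hrρ2 hr0 (by linarith)]
  have hW0 : 0 ≤ W := le_trans hWlo0 hWloW
  -- term 1
  have h1 : kap * q1 * Wlo * Wlo ≤ kap * Q * W ^ 2 := by
    have : Wlo * Wlo ≤ W * W := mul_le_mul hWloW hWloW hWlo0 hW0
    have : q1 * (Wlo * Wlo) ≤ Q * (W * W) := mul_le_mul hQq1 this (by positivity) hQ0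
    nlinarith
  -- term 2
  have hqq0 : 0 ≤ Q * (1 - Q) := mul_nonneg hQ0 (by linarith)
  have h2 : 9 * (Q * (1 - Q)) * r * W ≤ 9 * qq * ρ2 * Whi := by
    have : (Q * (1 - Q)) * r ≤ qq * ρ2 := mul_le_mul hqq hrρ2 hr0 (le_trans hqq0 hqq)
    have : (Q * (1 - Q)) * r * W ≤ qq * ρ2 * Whi := mul_le_mul this hWWhi hW0 (by nlinarith)
    nlinarith
  -- term 3
  have h3 : limI Q r ≤ ρ2 * (ρ2 - 1) * (ρ2 - 1) * (1 - q1) * (1 - q1) := by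
    unfold limI
    have ha : (r - 1) ^ 2 ≤ (ρ2 - 1) ^ 2 := by nlinarith
    have hb : (1 - Q) ^ 2 ≤ (1 - q1) ^ 2 := by nlinarith
    have hab : (r - 1) ^ 2 * (1 - Q) ^ 2 ≤ (ρ2 - 1) ^ 2 * (1 - q1) ^ 2 := mul_le_mul ha hb (by positivity) (by positivity)
    have : r * ((r - 1) ^ 2 * (1 - Q) ^ 2) ≤ ρ2 * ((ρ2 - 1) ^ 2 * (1 - q1) ^ 2) := mul_le_mul hrρ2 hab (by positivity) (by linarith)
    nlinarith
  rw [asecF_PH_eq]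
  nlinarith [mul_le_mul_of_nonneg_left h3 (by linarith : (0:ℝ) ≤ 1 - kap)]

/-- A-half-plane read on a box. -/
theorem ahp_ge_box {Q r q1 q2 ρ1 ρ2 : ℝ} (hq1 : 0 ≤ q1) (hQq1 : q1 ≤ Q) (hQq2 : Q ≤ q2) (hQ1 : Q ≤ 1)
    (hρ1 : 0 ≤ ρ1) (hrρ1 : ρ1 ≤ r) (hr1 : 1 ≤ r) (hrρ2 : r ≤ ρ2)
    (hinner : 0 ≤ (ρ1 * ρ1 + 1 + 2 * q1 * ρ1) - 9 * (1 - q1) * ρ2)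
    (hF : 0 ≤ 64 * (q1 * (ρ1 * ρ1 + 1 + 2 * q1 * ρ1) * ((ρ1 * ρ1 + 1 + 2 * q1 * ρ1) - 9 * (1 - q1) * ρ2))
              * (q1 * (ρ1 * ρ1 + 1 + 2 * q1 * ρ1) * ((ρ1 * ρ1 + 1 + 2 * q1 * ρ1) - 9 * (1 - q1) * ρ2))
            - (ρ2 * ((1 + q2 * ρ2) * (1 + q2 * ρ2)) * ((q2 + ρ2) * (q2 + ρ2)))
              * (q2 * (ρ2 * ρ2 + 1 + 2 * q2 * ρ2) * (ρ2 * ρ2 + 1 + 2 * q2 * ρ2)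
                 + ρ2 * (ρ2 - 1) * (ρ2 - 1) * (1 - q1) * (1 - q1))) :
    0 ≤ ahpX (9 / 2) 1 Q r ∧ 0 ≤ ahpF (9 / 2) 1 Q r 1 := by
  have hQ0 : 0 ≤ Q := le_trans hq1 hQq1
  have hr0 : 0 ≤ r := by linarith
  have hq2 : 0 ≤ q2 := le_trans hQ0 hQq2
  set W := limW Q r with hW
  set Wlo := ρ1 * ρ1 + 1 + 2 * q1 * ρ1 with hWlo
  set Whi := ρ2 * ρ2 + 1 + 2 * q2 * ρ2 with hWhi
  set ilo := Wlo - 9 * (1 - q1) * ρ2 with hilo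
  set Xlo := q1 * Wlo * ilo with hXlo
  set Ehi := ρ2 * ((1 + q2 * ρ2) * (1 + q2 * ρ2)) * ((q2 + ρ2) * (q2 + ρ2)) with hEhi
  set Ihi := ρ2 * (ρ2 - 1) * (ρ2 - 1) * (1 - q1) * (1 - q1) with hIhi
  have hWdef : W = r ^ 2 + 1 + 2 * Q * r := by rw [hW]; unfold limW; ring
  have hWlo0 : 0 ≤ Wlo := by rw [hWlo]; positivity
  have hWloW : Wlo ≤ W := by
    clear hF hinner; rw [hWdef, hWlo]
    nlinarith [mul_le_mul hQq1 hrρ1 hρ1 hQ0, mul_le_mul hrρ1 hrρ1 hρ1 hr0]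
  have hWWhi : W ≤ Whi := by
    clear hF hinner; rw [hWdef, hWhi]
    nlinarith [mul_le_mul hQq2 hrρ2 hr0 hq2, mul_le_mul hrρ2 hrρ2 hr0 (by linarith)]
  have hW0 : 0 ≤ W := le_trans hWlo0 hWloW
  -- inner factor
  have hin : ilo ≤ W - 9 * (1 - Q) * r := by
    clear hF hinner; rw [hilo]
    have : (1 - Q) * r ≤ (1 - q1) * ρ2 := mul_le_mul (by linarith) hrρ2 hr0 (by linarith)
    nlinarith
  have hX : Xlo ≤ ahpX (9 / 2) 1 Q r := by
    rw [ahpX_PH_eq, hXlo]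
    have h1 : q1 * Wlo ≤ Q * W := mul_le_mul hQq1 hWloW hWlo0 hQ0
    exact mul_le_mul h1 hin hinner (by positivity)
  have hXlo0 : 0 ≤ Xlo := by rw [hXlo]; positivity
  refine ⟨le_trans hXlo0 hX, ?_⟩
  -- E and N upper bounds
  have hE : limE Q r ≤ Ehi := by
    clear hF hinner hX hin; unfold limE; rw [hEhi]
    have ha : (1 + Q * r) ^ 2 ≤ (1 + q2 * ρ2) * (1 + q2 * ρ2) := by
      have : Q * r ≤ q2 * ρ2 := mul_le_mul hQq2 hrρ2 hr0 hq2
      have h0 : 0 ≤ 1 + Q * r := by positivity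
      nlinarith [mul_le_mul (by linarith : 1 + Q * r ≤ 1 + q2 * ρ2) (by linarith : 1 + Q * r ≤ 1 + q2 * ρ2) h0 (by linarith)]
    have hb : (Q + r) ^ 2 ≤ (q2 + ρ2) * (q2 + ρ2) := by
      have h0 : 0 ≤ Q + r := by positivity
      nlinarith [mul_le_mul (by linarith : Q + r ≤ q2 + ρ2) (by linarith : Q + r ≤ q2 + ρ2) h0 (by linarith)]
    have hab : (1 + Q * r) ^ 2 * (Q + r) ^ 2 ≤ ((1 + q2 * ρ2) * (1 + q2 * ρ2)) * ((q2 + ρ2) * (q2 + ρ2)) :=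
      mul_le_mul ha hb (by positivity) (le_trans (by positivity) ha)
    have := mul_le_mul hrρ2 hab (by positivity) (by linarith)
    linarith
  have hI : limI Q r ≤ Ihi := by
    clear hF hinner hX hin hE; unfold limI; rw [hIhi]
    have ha : (r - 1) ^ 2 ≤ (ρ2 - 1) ^ 2 := by nlinarith
    have hb : (1 - Q) ^ 2 ≤ (1 - q1) ^ 2 := by nlinarith
    have hab : (r - 1) ^ 2 * (1 - Q) ^ 2 ≤ (ρ2 - 1) ^ 2 * (1 - q1) ^ 2 := mul_le_mul ha hb (by positivity) (by positivity)
    have : r * ((r - 1) ^ 2 * (1 - Q) ^ 2) ≤ ρ2 * ((ρ2 - 1) ^ 2 * (1 - q1) ^ 2) := mul_le_mul hrρ2 hab (by positivity) (by linarith)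
    linarith
  have hN : limN Q r ≤ q2 * Whi * Whi + Ihi := by
    clear hF hinner hX hin hE; unfold limN
    have : Q * W ^ 2 ≤ q2 * (Whi * Whi) := by
      have hww : W ^ 2 ≤ Whi * Whi := by nlinarith [mul_le_mul hWWhi hWWhi hW0 (le_trans hW0 hWWhi)]
      exact mul_le_mul hQq2 hww (by positivity) hq2
    rw [← hW]; linarith
  have hE0 : 0 ≤ limE Q r := by unfold limE; positivity
  have hN0 : 0 ≤ limN Q r := by unfold limN; have := limI_nonneg' Q r hr0; positivity
  have hXX : Xlo * Xlo ≤ ahpX (9 / 2) 1 Q r ^ 2 := by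
    rw [sq]; exact mul_le_mul hX hX hXlo0 (le_trans hXlo0 hX)
  have hEN : limE Q r * limN Q r ≤ Ehi * (q2 * Whi * Whi + Ihi) := mul_le_mul hE hN hN0 (le_trans hE0 hE)
  unfold ahpF
  linarith

/-! ## §4 Soundness: free regions, `qqF`, one leaf, the recursion -/

/-- the PH reads at a chart point. -/
def PHReads (Q r : ℝ) : Prop :=
  0 ≤ asecF (9 / 2) 1 Q r ∨ (0 ≤ ahpX (9 / 2) 1 Q r ∧ 0 ≤ ahpF (9 / 2) 1 Q r 1) ∨ 0 ≤ thpF (9 / 25) Q r (limMu r)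

/-- TOP STRIP (= «LimitMenuRooms» v3 `asecF_nonneg_of_top` at `(J0, D0) = (9/2, 1)`): `10(1 − Q) ≤ κQr ⇒ 0 ≤ asecF`. -/
theorem asecF_nonneg_of_top' (Q r : ℝ) (hQ0 : 0 ≤ Q) (hQ1 : Q ≤ 1) (hr : 1 ≤ r)
    (h : 10 * (1 - Q) ≤ kap * Q * r) : 0 ≤ asecF (9 / 2) 1 Q r := by
  have hr0 : (0:ℝ) ≤ r := by linarith
  have hk : (0:ℝ) < kap := by unfold kap; norm_num
  have hW := sq_le_limW Q r hQ0 hr0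
  have hW0 : 0 ≤ limW Q r := (limW_pos Q r hQ0 hr0).le
  have hI0 := limI_nonneg' Q r hr0
  have hIW : limI Q r ≤ (1 - Q) * r * limW Q r := by
    unfold limI
    have h1 : (r - 1) ^ 2 ≤ limW Q r := by unfold limW; nlinarith
    have h2 : (1 - Q) ^ 2 ≤ 1 - Q := by nlinarith
    nlinarith [mul_le_mul h1 h2 (by positivity) hW0, mul_nonneg hr0 (sub_nonneg.2 hQ1)]
  have hPhi : (9 / 2 : ℝ) * limPhi Q r ≤ 9 * (1 - Q) * r * limW Q r := by
    unfold limPhi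
    have : 0 ≤ (1 - Q) * r * limW Q r := by have := sub_nonneg.2 hQ1; positivity
    nlinarith
  have hmain : 0 ≤ kap * Q * limW Q r ^ 2 - 9 * (1 - Q) * r * limW Q r - (1 - Q) * r * limW Q r := by
    have h1 : 0 ≤ r * limW Q r * (kap * Q * r - 10 * (1 - Q)) :=
      mul_nonneg (mul_nonneg hr0 hW0) (by linarith)
    have h2 : kap * Q * r ^ 2 * limW Q r ≤ kap * Q * limW Q r ^ 2 := by
      have : 0 ≤ kap * Q * limW Q r := by positivity
      nlinarith [mul_le_mul_of_nonneg_left hW this]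
    nlinarith
  unfold asecF limN
  nlinarith

/-- BOTTOM REGION (= v3 `thpF_nonneg_of_bottom` at `g0 = 9/25`): `8(1 + Qr) ≤ 64g0(1 − Q) ⇒ 0 ≤ thpF`. -/
theorem thpF_nonneg_of_bottom' (Q r : ℝ) (hQ0 : 0 ≤ Q) (hQ1 : Q ≤ 1) (hr : 1 ≤ r)
    (h : 8 * (1 + Q * r) ≤ 64 * (9 / 25) * (1 - Q)) : 0 ≤ thpF (9 / 25) Q r (limMu r) := by
  have hr0 : (0:ℝ) ≤ r := by linarith
  have hμ : limMu r ≤ 8 / (r + 1) := min_le_left _ _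
  have hμ0 : 0 ≤ limMu r := by
    unfold limMu; apply le_min
    · apply div_nonneg (by norm_num); linarith
    · norm_num
  have hu : 0 ≤ (Q * r + 1) * (Q + r) := by positivity
  have h1 : limMu r * ((Q * r + 1) * (Q + r)) ≤ 8 / (r + 1) * ((Q * r + 1) * (Q + r)) :=
    mul_le_mul_of_nonneg_right hμ hu
  have h2 : 8 / (r + 1) * ((Q * r + 1) * (Q + r)) ≤ 8 * (Q * r + 1) := by
    rw [div_mul_eq_mul_div, div_le_iff₀ (by linarith)]
    nlinarith [mul_nonneg (by positivity : (0:ℝ) ≤ 8 * (Q * r + 1)) (sub_nonneg.2 hQ1)]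
  unfold thpF
  nlinarith

/-- `Q(1 − Q) ≤ qqF Q1 Q2` for `Q ∈ [Q1, Q2]`. -/
theorem qq_sound (Q1 Q2 : Frac) {Q : ℝ} (h1 : Q1.toR ≤ Q) (h2 : Q ≤ Q2.toR) : Q * (1 - Q) ≤ (qqF Q1 Q2).toR := by
  unfold qqF
  by_cases hc : (Q1.leB halfF && halfF.leB Q2) = true
  · rw [if_pos hc, toR_quarterF]; nlinarith [sq_nonneg (Q - 1 / 2)]
  · rw [if_neg hc, Frac.toR_max]
    simp only [Frac.toR_mul, Frac.toR_sub, Frac.toR_lit, Nat.cast_one]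
    simp only [Bool.and_eq_true, Frac.leB_iff, toR_halfF, not_and_or, not_le] at hc
    rcases hc with hc | hc
    · exact le_max_of_le_left (by nlinarith)
    · exact le_max_of_le_right (by nlinarith)

/-- ★ ONE LEAF: `leafOK = true` certifies the PH reads on the box (clamped to the chart). -/
theorem leafOK_sound {Q1 Q2 r1 r2 : Frac} (h : leafOK Q1 Q2 r1 r2 = true) {Q r : ℝ}
    (hQ1 : Q1.toR ≤ Q) (hQ2 : Q ≤ Q2.toR) (hr1 : r1.toR ≤ r) (hr2 : r ≤ r2.toR)
    (hQ0 : 0 ≤ Q) (hQone : Q ≤ 1) (hrone : 1 ≤ r) : PHReads Q r := by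
  -- the clamped endpoints as reals
  have hq1 : 0 ≤ (Frac.max Q1 0).toR ∧ (Frac.max Q1 0).toR ≤ Q := by
    rw [Frac.toR_max]; simp only [Frac.toR_lit, Nat.cast_zero]
    exact ⟨le_max_right _ _, max_le hQ1 hQ0⟩
  have hq2 : Q ≤ (Frac.min Q2 1).toR ∧ (Frac.min Q2 1).toR ≤ 1 := by
    rw [Frac.toR_min]; simp only [Frac.toR_lit, Nat.cast_one]
    exact ⟨le_min hQ2 hQone, min_le_right _ _⟩
  have hρ1 : 1 ≤ (Frac.max r1 1).toR ∧ (Frac.max r1 1).toR ≤ r := by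
    rw [Frac.toR_max]; simp only [Frac.toR_lit, Nat.cast_one]
    exact ⟨le_max_right _ _, max_le hr1 hrone⟩
  have hr0 : 0 ≤ r := by linarith
  unfold PHReads
  simp only [leafOK, Bool.or_eq_true, Bool.and_eq_true] at h
  rcases h with hT | hA | ⟨hI, hF⟩
  · -- T read
    right; right
    have hT' := Frac.nonneg_of_nonnegB hT
    simp only [Frac.toR_sub, Frac.toR_mul, Frac.toR_add, Frac.toR_lit, toR_g0F, Nat.cast_ofNat, Nat.cast_one] at hT'
    have hμ := limMu_le_muHi (Frac.max r1 1) hr0 hρ1.2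
    linarith [thpF_ge_box hQ0 hq2.1 hrone hr2 hμ]
  · -- A-sector read
    left
    have hA' := Frac.nonneg_of_nonnegB hA
    simp only [Frac.toR_sub, Frac.toR_mul, Frac.toR_lit, toR_kapF, toR_Wf, Nat.cast_ofNat, Nat.cast_one] at hA'
    have hk : kap = 27 / 256 := by unfold kap; norm_num
    have := asecF_ge_box hq1.1 hq1.2 hq2.1 hQone (by linarith [hρ1.1]) hρ1.2 hrone hr2 (qq_sound _ _ hq1.2 hq2.1)
    rw [hk] at this
    linarith
  · -- A-half-plane read
    right; left
    have hI' := Frac.nonneg_of_nonnegB hI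
    have hF' := Frac.nonneg_of_nonnegB hF
    simp only [Frac.toR_sub, Frac.toR_mul, Frac.toR_add, Frac.toR_lit, toR_Wf, Nat.cast_ofNat, Nat.cast_one] at hI' hF'
    exact ahp_ge_box hq1.1 hq1.2 hq2.1 hQone (by linarith [hρ1.1]) hρ1.2 hrone hr2 (by linarith) (by linarith)

/-- ★ FREE BOX: `inFree = true` certifies the reads (A-sector on the top strip / T on the bottom region). -/
theorem inFree_sound {Q1 Q2 r1 r2 : Frac} (h : inFree Q1 Q2 r1 r2 = true) {Q r : ℝ}
    (hQ1 : Q1.toR ≤ Q) (hQ2 : Q ≤ Q2.toR) (hr1 : r1.toR ≤ r) (hr2 : r ≤ r2.toR)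
    (hQ0 : 0 ≤ Q) (hQone : Q ≤ 1) (hrone : 1 ≤ r) : PHReads Q r := by
  have hq1 : 0 ≤ (Frac.max Q1 0).toR ∧ (Frac.max Q1 0).toR ≤ Q := by
    rw [Frac.toR_max]; simp only [Frac.toR_lit, Nat.cast_zero]
    exact ⟨le_max_right _ _, max_le hQ1 hQ0⟩
  have hq2 : Q ≤ (Frac.min Q2 1).toR ∧ (Frac.min Q2 1).toR ≤ 1 := by
    rw [Frac.toR_min]; simp only [Frac.toR_lit, Nat.cast_one]
    exact ⟨le_min hQ2 hQone, min_le_right _ _⟩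
  have hρ1 : 1 ≤ (Frac.max r1 1).toR ∧ (Frac.max r1 1).toR ≤ r := by
    rw [Frac.toR_max]; simp only [Frac.toR_lit, Nat.cast_one]
    exact ⟨le_max_right _ _, max_le hr1 hrone⟩
  have hr0 : 0 ≤ r := by linarith
  have hk : (0:ℝ) < kap := by unfold kap; norm_num
  unfold PHReads
  simp only [inFree, Bool.or_eq_true] at h
  rcases h with h | h
  · left
    have h' := Frac.le_of_leB h
    simp only [Frac.toR_sub, Frac.toR_mul, Frac.toR_lit, toR_kapF, Nat.cast_ofNat, Nat.cast_one] at h'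
    apply asecF_nonneg_of_top' Q r hQ0 hQone hrone
    have hk' : kap = 27 / 256 := by unfold kap; norm_num
    have : (27 / 256 : ℝ) * (Frac.max Q1 0).toR * (Frac.max r1 1).toR ≤ 27 / 256 * Q * r := by
      have := mul_le_mul hq1.2 hρ1.2 (by linarith [hρ1.1]) hQ0
      nlinarith
    rw [hk']; linarith
  · right; right
    have h' := Frac.le_of_leB h
    simp only [Frac.toR_sub, Frac.toR_mul, Frac.toR_add, Frac.toR_lit, toR_g0F, Nat.cast_ofNat, Nat.cast_one] at h'
    apply thpF_nonneg_of_bottom' Q r hQ0 hQone hrone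
    have : Q * r ≤ (Frac.min Q2 1).toR * r2.toR := mul_le_mul hq2.1 hr2 hr0 (by linarith [hq2.1])
    linarith

/-- ★★ SOUNDNESS of the branch-and-bound. -/
theorem bb_sound : ∀ (d : Nat) (Q1 Q2 r1 r2 : Frac), bb d Q1 Q2 r1 r2 = true →
    ∀ Q r : ℝ, Q1.toR ≤ Q → Q ≤ Q2.toR → r1.toR ≤ r → r ≤ r2.toR → 0 ≤ Q → Q ≤ 1 → 1 ≤ r → PHReads Q r
  | 0, Q1, Q2, r1, r2, h, Q, r, hQ1, hQ2, hr1, hr2, hQ0, hQone, hrone => by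
    simp only [bb, Bool.or_eq_true] at h
    rcases h with h | h
    · exact inFree_sound h hQ1 hQ2 hr1 hr2 hQ0 hQone hrone
    · exact leafOK_sound h hQ1 hQ2 hr1 hr2 hQ0 hQone hrone
  | d + 1, Q1, Q2, r1, r2, h, Q, r, hQ1, hQ2, hr1, hr2, hQ0, hQone, hrone => by
    simp only [bb, Bool.or_eq_true] at h
    rcases h with (h | h) | h
    · exact inFree_sound h hQ1 hQ2 hr1 hr2 hQ0 hQone hrone
    · exact leafOK_sound h hQ1 hQ2 hr1 hr2 hQ0 hQone hrone
    · split at h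
      · rw [Bool.and_eq_true] at h
        rcases le_total Q (Frac.mid Q1 Q2).toR with hm | hm
        · exact bb_sound d _ _ _ _ h.1 Q r hQ1 hm hr1 hr2 hQ0 hQone hrone
        · exact bb_sound d _ _ _ _ h.2 Q r hm hQ2 hr1 hr2 hQ0 hQone hrone
      · rw [Bool.and_eq_true] at h
        rcases le_total r (Frac.mid r1 r2).toR with hm | hm
        · exact bb_sound d _ _ _ _ h.1 Q r hQ1 hQ2 hr1 hm hQ0 hQone hrone
        · exact bb_sound d _ _ _ _ h.2 Q r hQ1 hQ2 hm hr2 hQ0 hQone hrone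

end RhW08.FlatMenuBB
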